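import Summits.CriticalPhenomena.PercolationContinuityZ3.Theorems.PercNearOneGluingNoHeavyQuantOneArmSteepness
import HarnessLib

/-!
# QUANT lane (p4 gen 20): THE PASSAGE TIME TO INFINITY `ρ` OF BERNOULLI FIRST-PASSAGE PERCOLATION ABOVE `p_c` —
# `E_s[ρ] ≤ log(θ(s)/θ(r))/(4(s−r)) ≤ log(1/(r−p_c))/(4(s−r))` for `p_c < r < s < 1`; `E_{p_c+t}[ρ] ≤ log(2/t)/(2t)`

builds on p205010 (kernel theorem, internal audit signed; external expert review pending) — NOT used in this file
(the companion `…QuantPassageTimeCritical` uses it to show `ρ = ∞` a.s. at `p_c`).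

Seat `prim-quant-p4` (METHOD = differential inequalities for `θ` near `p_c`), helper file `--supports
stmt-CriticalPhenomena-4575`; pure proofs, no definitions (objects: `…QuantPassageTimeDefs`; steepness for `θ_n`:
`…QuantOneArmSteepness`).  Notation as there: `ρ = lim_n T_n` the passage time to infinity (Auffinger–Damron–Hanson (3.25)),
`rhoLE d k = {ρ ≤ k} = ⋂_n {T_n ≤ k}`, `meanRhoUpTo d K p = Σ_{k<K} P_p(ρ > k)` (partial sums of `E_p[ρ]`),
`θ(r) = θ(projIcc r)`, `p_c = criticalProb (zdGraph d) 0`.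

* `tendsto_real_passTimeLE` — `P_p(T_n ≤ k) ↓ P_p(ρ ≤ k)` (continuity of the measure); `tendsto_sum_passTimeLE`;
* **`meanRhoUpTo_le_log_div`** — for `d ≥ 2`, `p_c < r < s < 1`, every `K`: `Σ_{k<K} P_s(ρ > k) ≤ log(θ(s)/θ(r))/(4(s−r))`
  (let `n → ∞` in `Σ_{k<K} P_s(T_n > k) ≤ E_s[T_n] ≤ log(θ_n(s)/θ_n(r))/(4(s−r)) ≤ log(θ_n(s)/θ(r))/(4(s−r))`): **`E_s[ρ] < ∞`
  throughout the supercritical phase**;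
* **`meanRhoUpTo_le_explicit`** — `≤ log(1/(r−p_c))/(4(s−r))` (`θ(s) ≤ 1`, mean-field bound `θ(r) ≥ r − p_c` of the tree);
  `meanRhoUpTo_le_log_div_self` — `E_{p_c+t}[ρ] ≤ log(2/t)/(2t)`.

HONEST STATUS.  That `T(0,x)` is stochastically bounded above `p_c` is classical (Zhang 1995; ADH 2017 §3.7.1); the finite
mean with an explicit bound through `θ` / `p − p_c` is bookkeeping on Grimmett–Piza's steepness (not found in print as
stated).  No rate at `p_c`; (T1)/(T2) unchanged.

## References
* G. Grimmett, *The Random-Cluster Model* (2006), §2.5 (2.56), §3.5 [GrimmettRandomCluster2006].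
* A. Auffinger, M. Damron, J. Hanson, *50 Years of First-Passage Percolation* (2017), §3.7.1 (3.25) [AuffingerDamronHanson2017].
* Y. Zhang, Stoch. Proc. Appl. 59 (1995) 251–266 [ZhangSupercriticalFPP1995].
* H. Duminil-Copin, V. Tassion, Enseign. Math. 62 (2016), Thm. 1.1(2) [DuminilCopinTassionEM2016].
-/

noncomputable section

namespace Summit.CriticalPhenomena.PercolationContinuityZ3.Theorems

namespace PassTime

open MeasureTheory Set Filter Literature.Probability.Percolation Literature.Probability.LatticeModels
open scoped Classical Topology

variable {d : ℕ}

/-- The real parameter `r ∈ [0,1]` read back from `Set.projIcc 0 1`. -/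
private theorem coe_projIcc_of_memS {r : ℝ} (h0 : 0 ≤ r) (h1 : r ≤ 1) :
    ((Set.projIcc (0 : ℝ) 1 zero_le_one r : unitInterval) : ℝ) = r :=
  congrArg Subtype.val (Set.projIcc_of_mem zero_le_one ⟨h0, h1⟩)

/-! ### The passage time to infinity `ρ` -/

/-- `{ρ ≤ k} ⊆ {T_n ≤ k}`. -/
theorem rhoLE_subset (d k n : ℕ) : rhoLE d k ⊆ passTimeLE d n k := Set.iInter_subset _ n

/-- `{ρ ≤ k}` is measurable. -/
theorem measurableSet_rhoLE (d k : ℕ) : MeasurableSet (rhoLE d k) :=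
  MeasurableSet.iInter fun n => measurableSet_passTimeLE d n k

/-- `P_p(ρ ≤ k) ≤ P_p(T_n ≤ k)`. -/
theorem real_rhoLE_le (p : unitInterval) (k n : ℕ) :
    (bondPercolation (zdGraph d) p).real (rhoLE d k) ≤ (bondPercolation (zdGraph d) p).real (passTimeLE d n k) :=
  measureReal_mono (rhoLE_subset d k n)

/-- **`P_p(T_n ≤ k) → P_p(ρ ≤ k)`** as `n → ∞` (continuity of the measure along the decreasing events `{T_n ≤ k}`). -/
theorem tendsto_real_passTimeLE (p : unitInterval) (k : ℕ) :
    Tendsto (fun n => (bondPercolation (zdGraph d) p).real (passTimeLE d n k)) atTop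
      (𝓝 ((bondPercolation (zdGraph d) p).real (rhoLE d k))) := by
  set μ := bondPercolation (zdGraph d) p with hμ
  have hanti : Antitone (fun n => passTimeLE d n k) := fun m n hmn => passTimeLE_anti hmn k
  have h := tendsto_measure_iInter_atTop (μ := μ) (fun n => (measurableSet_passTimeLE d n k).nullMeasurableSet) hanti
    ⟨0, measure_ne_top μ _⟩
  have h' := (ENNReal.tendsto_toReal (measure_ne_top μ (⋂ n, passTimeLE d n k))).comp h
  simpa [Function.comp_def, measureReal_def, rhoLE] using h'

/-- `0 ≤ Σ_{k<K} P_p(ρ > k)`. -/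
theorem meanRhoUpTo_nonneg (d K : ℕ) (p : unitInterval) : 0 ≤ meanRhoUpTo d K p :=
  Finset.sum_nonneg fun k _ => by
    linarith [measureReal_le_one (μ := bondPercolation (zdGraph d) p) (s := rhoLE d k)]

/-- `K ↦ Σ_{k<K} P_p(ρ > k)` is non-decreasing. -/
theorem meanRhoUpTo_mono (d : ℕ) (p : unitInterval) : Monotone fun K => meanRhoUpTo d K p := by
  intro K K' hKK
  exact Finset.sum_le_sum_of_subset_of_nonneg (Finset.range_mono hKK) fun k _ _ => by
    linarith [measureReal_le_one (μ := bondPercolation (zdGraph d) p) (s := rhoLE d k)]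

/-- The partial sums of `E_p[ρ]` are limits of partial sums of `E_p[T_n]`:
`Σ_{k<K} P_p(T_n > k) → Σ_{k<K} P_p(ρ > k)` as `n → ∞`. -/
theorem tendsto_sum_passTimeLE (p : unitInterval) (K : ℕ) :
    Tendsto (fun n => ∑ k ∈ Finset.range K, (1 - (bondPercolation (zdGraph d) p).real (passTimeLE d n k))) atTop
      (𝓝 (meanRhoUpTo d K p)) := by
  unfold meanRhoUpTo
  exact tendsto_finsetSum _ fun k _ => (tendsto_real_passTimeLE p k).const_sub 1

/-- **`E_s[ρ] ≤ log(θ(s)/θ(r))/(4(s−r))` (partial sums)**: for `d ≥ 2`, `p_c < r < s < 1` and every `K`,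
`Σ_{k<K} P_s(ρ > k) ≤ log(θ(s)/θ(r))/(4(s−r))` — the passage time to infinity of Bernoulli first-passage percolation
has FINITE MEAN throughout the supercritical phase (letting `n → ∞` in `Σ_{k<K} P_s(T_n > k) ≤ E_s[T_n] ≤
log(θ_n(s)/θ_n(r))/(4(s−r)) ≤ log(θ_n(s)/θ(r))/(4(s−r))`, with `θ ≤ θ_n`, `θ_n ↓ θ`, `θ(r) > 0`). -/
theorem meanRhoUpTo_le_log_div (hd : 2 ≤ d) {r s : ℝ} (hpc : criticalProb (zdGraph d) (0 : Site d) < r)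
    (hrs : r < s) (hs : s < 1) (K : ℕ) :
    meanRhoUpTo d K (Set.projIcc 0 1 zero_le_one s) ≤
      Real.log (theta (zdGraph d) 0 (Set.projIcc 0 1 zero_le_one s) / theta (zdGraph d) 0 (Set.projIcc 0 1 zero_le_one r)) /
        (4 * (s - r)) := by
  have hd1 : 1 ≤ d := le_trans (by norm_num) hd
  have hpc0 : 0 ≤ criticalProb (zdGraph d) (0 : Site d) := (criticalProb_mem_Icc _ _).1
  have hr : 0 < r := lt_of_le_of_lt hpc0 hpc
  have hcr := coe_projIcc_of_memS hr.le (hrs.le.trans hs.le)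
  have hcs := coe_projIcc_of_memS (hr.le.trans hrs.le) hs.le
  set pr : unitInterval := Set.projIcc 0 1 zero_le_one r with hpr
  set ps : unitInterval := Set.projIcc 0 1 zero_le_one s with hps
  -- `θ(r) > 0`, `θ(r) ≤ θ_n(r)`, `θ_n(s) → θ(s) > 0`
  have hθr : 0 < theta (zdGraph d) 0 pr := theta_pos_of_criticalProb_lt_holds (zdGraph d) 0 pr (by rw [hcr]; exact hpc)
  have hθs : 0 < theta (zdGraph d) 0 ps :=
    theta_pos_of_criticalProb_lt_holds (zdGraph d) 0 ps (by rw [hcs]; exact hpc.trans hrs)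
  have h4 : 0 < 4 * (s - r) := by linarith
  -- for each `n`: `Σ_{k<K} P_s(T_n > k) ≤ log(θ_n(s)/θ(r))/(4(s−r))`
  have hn : ∀ n : ℕ, ∑ k ∈ Finset.range K, (1 - (bondPercolation (zdGraph d) ps).real (passTimeLE d n k)) ≤
      Real.log (DCT16.thetaN d n s / theta (zdGraph d) 0 pr) / (4 * (s - r)) := by
    intro n
    have h1 := sum_le_meanPassTime hd1 ps n K
    have h2 := meanPassTime_le_log_div hd1 n hr hrs hs
    have hθnr : theta (zdGraph d) 0 pr ≤ DCT16.thetaN d n r := DCT16.theta_le_real_siteToBoundary pr n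
    have hθns : 0 < DCT16.thetaN d n s := DKT20.real_siteToBoundary_pos hd1 _ (by rw [hcs]; exact hr.trans hrs) n
    have hθnr' : 0 < DCT16.thetaN d n r := hθr.trans_le hθnr
    have h3 : Real.log (DCT16.thetaN d n s / DCT16.thetaN d n r) ≤ Real.log (DCT16.thetaN d n s / theta (zdGraph d) 0 pr) :=
      Real.log_le_log (div_pos hθns hθnr') (div_le_div_of_nonneg_left hθns.le hθr hθnr)
    calc _ ≤ meanPassTime d n ps := h1
      _ ≤ Real.log (DCT16.thetaN d n s / DCT16.thetaN d n r) / (4 * (s - r)) := h2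
      _ ≤ _ := div_le_div_of_nonneg_right h3 h4.le
  -- pass to the limit `n → ∞`
  have hlim1 := tendsto_sum_passTimeLE (d := d) ps K
  have hlim2 : Tendsto (fun n => Real.log (DCT16.thetaN d n s / theta (zdGraph d) 0 pr) / (4 * (s - r))) atTop
      (𝓝 (Real.log (theta (zdGraph d) 0 ps / theta (zdGraph d) 0 pr) / (4 * (s - r)))) := by
    have ht : Tendsto (fun n => DCT16.thetaN d n s) atTop (𝓝 (theta (zdGraph d) 0 ps)) :=
      tendsto_real_siteToBoundary ps
    exact ((Real.continuousAt_log (div_pos hθs hθr).ne').tendsto.comp (ht.div_const _)).div_const _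
  exact le_of_tendsto_of_tendsto' hlim1 hlim2 hn

/-- **Explicit bound: `E_s[ρ] ≤ log(1/(r − p_c))/(4(s−r))`** for `d ≥ 2`, `p_c < r < s < 1` and every `K`
(`θ(s) ≤ 1` and the mean-field lower bound `θ(r) ≥ r − p_c` of Aizenman–Barsky / Duminil-Copin–Tassion, tree
`sub_criticalProb_le_theta`); e.g. with `r = (p_c + s)/2`: `E_{p_c+t}[ρ] ≤ log(2/t)/(2t)`. -/
theorem meanRhoUpTo_le_explicit (hd : 2 ≤ d) {r s : ℝ} (hpc : criticalProb (zdGraph d) (0 : Site d) < r)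
    (hrs : r < s) (hs : s < 1) (K : ℕ) :
    meanRhoUpTo d K (Set.projIcc 0 1 zero_le_one s) ≤
      Real.log (1 / (r - criticalProb (zdGraph d) (0 : Site d))) / (4 * (s - r)) := by
  have hpc0 : 0 ≤ criticalProb (zdGraph d) (0 : Site d) := (criticalProb_mem_Icc _ _).1
  have hr : 0 < r := lt_of_le_of_lt hpc0 hpc
  have hcr := coe_projIcc_of_memS hr.le (hrs.le.trans hs.le)
  have hcs := coe_projIcc_of_memS (hr.le.trans hrs.le) hs.le
  set pr : unitInterval := Set.projIcc 0 1 zero_le_one r with hpr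
  set ps : unitInterval := Set.projIcc 0 1 zero_le_one s with hps
  have h := meanRhoUpTo_le_log_div hd hpc hrs hs K
  have hθr : r - criticalProb (zdGraph d) 0 ≤ theta (zdGraph d) 0 pr := by
    have := sub_criticalProb_le_theta hd pr (by rw [hcr]; exact hpc.le)
    rwa [hcr] at this
  have hθr0 : 0 < r - criticalProb (zdGraph d) 0 := by linarith
  have hθs1 : theta (zdGraph d) 0 ps ≤ 1 := measureReal_le_one
  have hθs : 0 < theta (zdGraph d) 0 ps :=
    theta_pos_of_criticalProb_lt_holds (zdGraph d) 0 ps (by rw [hcs]; exact hpc.trans hrs)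
  have h4 : 0 < 4 * (s - r) := by linarith
  refine h.trans (div_le_div_of_nonneg_right (Real.log_le_log (div_pos hθs (hθr0.trans_le hθr)) ?_) h4.le)
  calc theta (zdGraph d) 0 ps / theta (zdGraph d) 0 pr ≤ 1 / theta (zdGraph d) 0 pr :=
        div_le_div_of_nonneg_right hθs1 (hθr0.trans_le hθr).le
    _ ≤ 1 / (r - criticalProb (zdGraph d) 0) := one_div_le_one_div_of_le hθr0 hθr

/-- **`E_{p_c+t}[ρ] ≤ log(2/t)/(2t)`** for `d ≥ 2`, `0 < t`, `p_c + t < 1` (partial sums; `r = p_c + t/2`). -/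
theorem meanRhoUpTo_le_log_div_self (hd : 2 ≤ d) {t : ℝ} (ht : 0 < t)
    (ht1 : criticalProb (zdGraph d) (0 : Site d) + t < 1) (K : ℕ) :
    meanRhoUpTo d K (Set.projIcc 0 1 zero_le_one (criticalProb (zdGraph d) (0 : Site d) + t)) ≤
      Real.log (2 / t) / (2 * t) := by
  have h := meanRhoUpTo_le_explicit hd (r := criticalProb (zdGraph d) (0 : Site d) + t / 2)
    (s := criticalProb (zdGraph d) (0 : Site d) + t) (by linarith) (by linarith) ht1 K
  have e1 : criticalProb (zdGraph d) (0 : Site d) + t / 2 - criticalProb (zdGraph d) 0 = t / 2 := by ring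
  have e2 : 4 * (criticalProb (zdGraph d) (0 : Site d) + t - (criticalProb (zdGraph d) 0 + t / 2)) = 2 * t := by ring
  rw [e1, e2, one_div_div] at h
  exact h

end PassTime

end Summit.CriticalPhenomena.PercolationContinuityZ3.Theorems

end
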